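import Literature.MathematicalPhysics.QuantumLattice.HubbardNNNHoppingPlaquetteFlux
import HarnessLib

/-!
# Gauge equivalence of the two Landau gauges of the plaquette-flux `t–t'` torus, and the magnetic
# translations (FL1 of the orbital-flux row)

Topic `Literature/MathematicalPhysics/QuantumLattice` (namespace = path; family `hubbard`). Companion of
`HubbardNNNHoppingPlaquetteFlux.lean` (`hubbardTorusTT'Plaquette L t' U m`: the `t–t'–U` torus with flux
`2πm/L` through every plaquette, Landau gauge `A_{x→x+e₂} = χ(m x₁)`, `χ = ZMod.toCircle`, straight-line phases
`(χ(m x₁)η_m)^{±1}` on the diagonal bonds), following the pattern of `HubbardTorusFluxGauge.lean` (seam gauge ↔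
uniform gauge by the explicit site gauge `twistGauge`): an explicit lattice gauge transformation relates the two
natural Landau gauges, whence unitary equivalence of the Hamiltonians and equality of all sector energies; and
the lattice translations act on the Landau field by gauge transformations (Zak's magnetic translations).
Everything is PROVED; the three `def`s are the only new objects.

## Contents

* `landauGaugeX L m` — the OTHER Landau gauge, `A_{x→x+e₁} = χ(−m x₂)`, `A_{x→x+e₂} = 1`, same flux `χ(m)` per
  plaquette (`u1Plaquette_landauGaugeX`); `landauDiagAmpX L m` — its straight-line diagonal phases
  `(χ(m x₂)η_m)⁻¹` on `x → x + e₁ + e₂`, `χ(−m x₂)η_m` on `x → x + e₁ − e₂`; `landauCross L m x = χ(m x₁ x₂)` —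
  the site gauge relating the two (`e^{iΦ x₁x₂}`, single valued as a function on `(ℤ/L)²` because `χ` is a
  character of the RING `ℤ/L`).
* **`gaugeTransform_landauCross_landauGauge`: `(landauGauge L m)^{landauCross} = landauGaugeX L m`** and
  `landauCross_mul_landauDiagAmp_mul_conj`: the diagonal phases transform into `landauDiagAmpX`.
* **`conj_hubbardTorusTT'Plaquette_eq_landauX`** (`W = phaseGauge landauCross`):
  `Wᴴ H^{(y)}_m W = H_{landauGaugeX}(1,U) − t'·D_{landauDiagAmpX}` — the two Landau-gauge Hamiltonians are
  unitarily equivalent — and `minEnergyOn_szSector_landauX_eq`: equal energies in every sector `(N, S^z = M)`.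
* MAGNETIC TRANSLATIONS (Zak): translating the Landau field by `e₂` leaves it invariant
  (`landauGauge_shift_one`, `landauDiagAmp_shift_one`); translating it by `e₁` is the gauge transformation by
  `x ↦ χ(−m x₂)` (`landauGauge_shift_zero`, `landauDiagAmp_shift_zero`) — the lattice-gauge content of the
  magnetic translation group; the operator statement (translation unitaries on Fock space) is left to the
  thermodynamic-limit file of the row (FL4).

HONEST SCOPE: finite-volume gauge bookkeeping; no number, nothing about superconductivity.

## References
* J. Zak, Phys. Rev. 134 (1964) A1602, §2 (magnetic translations = translation × gauge phase). [cite: Zak1964, §2]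
* D. R. Hofstadter, Phys. Rev. B 14 (1976) 2239, §II (the two Landau gauges). [cite: Hofstadter1976, §II]
* E. H. Lieb, PRL 73 (1994) 2158, eqs. (1)–(2) and the gauge-invariance remark. [cite: Lieb1994, eqs. (1)-(2)]
* H. Watanabe, J. Stat. Phys. 177 (2019) 717, §2.2.1 (`U H U†` for site-phase unitaries). [cite: Watanabe2019, §2.2.1]
-/

noncomputable section

namespace Literature.MathematicalPhysics.QuantumLattice

open _root_.Matrix Finset Literature.MathematicalPhysics.QuantumFieldTheory HubbardWave0
open Literature.Barriers.QuantumFields (u1Plaquette)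
open scoped ComplexConjugate Real

variable (L : ℕ) [NeZero L]

/-! ### The second Landau gauge and the cross gauge -/

/-- The **`x`-Landau gauge**: `χ(−m x₂)` on every `e₁`-edge `(x, x + e₁)`, `1` on the `e₂`-edges (Hofstadter's
`A = (−By, 0)`), flux `χ(m)` per plaquette. [cite: Hofstadter1976, §II] -/
def landauGaugeX (m : ℤ) : GaugeConfig 2 L Circle :=
  fun e => if e.2 = 0 then ZMod.toCircle (-((m : ZMod L) * e.1 1)) else 1

/-- The straight-line diagonal Peierls amplitudes of the `x`-Landau gauge: `(χ(m x₂)η_m)⁻¹ = e^{−iΦ(x₂+½)}` on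
`x → x + e₁ + e₂` and `χ(−m x₂)η_m = e^{−iΦ(x₂−½)}` on `x → x + e₁ − e₂`. [cite: Lieb1994, eqs. (1)-(2)] -/
def landauDiagAmpX (m : ℤ) : Fin 2 → Site 2 L → ℂ :=
  fun s x => if s = 0 then (((ZMod.toCircle ((m : ZMod L) * x 1) * halfFluxPhase L m)⁻¹ : Circle) : ℂ)
    else ((ZMod.toCircle (-((m : ZMod L) * x 1)) * halfFluxPhase L m : Circle) : ℂ)

/-- The **cross gauge** `g(x) = χ(m x₁ x₂) = e^{iΦ x₁ x₂}` relating the two Landau gauges. [cite: Hofstadter1976, §II] -/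
def landauCross (m : ℤ) (x : Site 2 L) : Circle := ZMod.toCircle ((m : ZMod L) * x 0 * x 1)

/-- The `x`-Landau field on an `e₁`-edge. [folklore] -/
@[simp] private theorem landauGaugeX_apply_zero (m : ℤ) (x : Site 2 L) :
    landauGaugeX L m (x, 0) = ZMod.toCircle (-((m : ZMod L) * x 1)) := by
  simp [landauGaugeX]

/-- The `x`-Landau field on an `e₂`-edge is trivial. [folklore] -/
@[simp] private theorem landauGaugeX_apply_one (m : ℤ) (x : Site 2 L) : landauGaugeX L m (x, 1) = 1 := by
  simp [landauGaugeX]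

/-- The `j₀` amplitude of the `x`-Landau gauge, unfolded. [folklore] -/
private theorem landauDiagAmpX_zero_apply (m : ℤ) (x : Site 2 L) :
    landauDiagAmpX L m 0 x = (((ZMod.toCircle ((m : ZMod L) * x 1) * halfFluxPhase L m)⁻¹ : Circle) : ℂ) := by
  simp [landauDiagAmpX]

/-- The `j₁` amplitude of the `x`-Landau gauge, unfolded. [folklore] -/
private theorem landauDiagAmpX_one_apply (m : ℤ) (x : Site 2 L) :
    landauDiagAmpX L m 1 x = ((ZMod.toCircle (-((m : ZMod L) * x 1)) * halfFluxPhase L m : Circle) : ℂ) := by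
  simp [landauDiagAmpX]

omit [NeZero L] in
/-- The `e₁`-shift moves `x₁` by one. [folklore] -/
private theorem shift_zero_apply_zero'' (x : Site 2 L) : (x.shift 0) 0 = x 0 + 1 := by simp [Site.shift]

omit [NeZero L] in
/-- The `e₂`-shift fixes `x₁`. [folklore] -/
private theorem shift_one_apply_zero'' (x : Site 2 L) : (x.shift 1) 0 = x 0 := by simp [Site.shift]

omit [NeZero L] in
/-- The `e₁`-shift fixes `x₂`. [folklore] -/
private theorem shift_zero_apply_one' (x : Site 2 L) : (x.shift 0) 1 = x 1 := by simp [Site.shift]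

omit [NeZero L] in
/-- The `e₂`-shift moves `x₂` by one. [folklore] -/
private theorem shift_one_apply_one' (x : Site 2 L) : (x.shift 1) 1 = x 1 + 1 := by simp [Site.shift]

omit [NeZero L] in
/-- Both diagonal jumps move `x₁` by `+1`. [folklore] -/
private theorem add_torusDiagJump_apply_zero' (x : Site 2 L) (s : Fin 2) : (x + torusDiagJump L s) 0 = x 0 + 1 := by
  simp [torusDiagJump]

omit [NeZero L] in
/-- The jump `j₀` moves `x₂` by `+1`. [folklore] -/
private theorem add_torusDiagJump_zero_apply_one' (x : Site 2 L) : (x + torusDiagJump L 0) 1 = x 1 + 1 := by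
  simp [torusDiagJump]

omit [NeZero L] in
/-- The jump `j₁` moves `x₂` by `−1`. [folklore] -/
private theorem add_torusDiagJump_one_apply_one' (x : Site 2 L) : (x + torusDiagJump L 1) 1 = x 1 - 1 := by
  simp [torusDiagJump, sub_eq_add_neg]

/-- An identity of the commutative group `Circle` holds as soon as it holds additively (tool for the
character algebra below). [folklore] -/
private theorem circle_eq_of_additive {z w : Circle} (h : Additive.ofMul z = Additive.ofMul w) : z = w :=
  Additive.ofMul.injective h

/-! ### The two Landau gauges are gauge equivalent -/

/-- The `x`-Landau gauge also carries the flux `χ(m)` through every plaquette. [cite: Hofstadter1976, §II] -/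
theorem u1Plaquette_landauGaugeX (m : ℤ) (x : Site 2 L) :
    u1Plaquette (landauGaugeX L m) x = ZMod.toCircle (m : ZMod L) := by
  rw [u1Plaquette, plaquetteHolonomy, landauGaugeX_apply_zero, landauGaugeX_apply_one, landauGaugeX_apply_zero,
    landauGaugeX_apply_one, shift_one_apply_one', mul_one, inv_one, mul_one, ← AddChar.map_neg_eq_inv,
    ← AddChar.map_add_eq_mul, show -((m : ZMod L) * x 1) + - -((m : ZMod L) * (x 1 + 1)) = m by ring]

/-- **The cross gauge carries the Landau gauge into the `x`-Landau gauge**: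
`gaugeTransform (landauCross L m) (landauGauge L m) = landauGaugeX L m`
(`χ(m x₁x₂)·χ(m x₁)·χ(m x₁(x₂+1))⁻¹ = 1` on `e₂`-edges, `χ(m x₁x₂)χ(m(x₁+1)x₂)⁻¹ = χ(−m x₂)` on `e₁`-edges).
[cite: Hofstadter1976, §II] -/
theorem gaugeTransform_landauCross_landauGauge (m : ℤ) :
    gaugeTransform (landauCross L m) (landauGauge L m) = landauGaugeX L m := by
  funext e
  obtain ⟨x, i⟩ := e
  simp only [gaugeTransform, landauCross]
  by_cases hi : i = 0
  · subst hi
    rw [landauGauge_apply_zero, landauGaugeX_apply_zero, mul_one, shift_zero_apply_zero'', shift_zero_apply_one',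
      ← AddChar.map_neg_eq_inv, ← AddChar.map_add_eq_mul,
      show (m : ZMod L) * x 0 * x 1 + -((m : ZMod L) * (x 0 + 1) * x 1) = -((m : ZMod L) * x 1) by ring]
  · obtain rfl : i = 1 := Fin.eq_one_of_ne_zero i hi
    rw [landauGauge_apply_one, landauGaugeX_apply_one, shift_one_apply_zero'', shift_one_apply_one',
      ← AddChar.map_neg_eq_inv, ← AddChar.map_add_eq_mul, ← AddChar.map_add_eq_mul,
      show (m : ZMod L) * x 0 * x 1 + (m : ZMod L) * x 0 + -((m : ZMod L) * x 0 * (x 1 + 1)) = 0 by ring,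
      AddChar.map_zero_eq_one]

/-- **The diagonal phases follow**: `g(x)·a_s(x)·conj g(x + j_s)` is the `x`-Landau diagonal phase.
[cite: Lieb1994, eqs. (1)-(2)] -/
theorem landauCross_mul_landauDiagAmp_mul_conj (m : ℤ) (s : Fin 2) (x : Site 2 L) :
    (landauCross L m x : ℂ) * landauDiagAmp L m s x * conj ((landauCross L m (x + torusDiagJump L s) : Circle) : ℂ) =
      landauDiagAmpX L m s x := by
  by_cases hs : s = 0
  · subst hs
    rw [landauDiagAmp_zero_apply, landauDiagAmpX_zero_apply, ← Circle.coe_inv_eq_conj, ← Circle.coe_mul,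
      ← Circle.coe_mul]
    congr 1
    simp only [landauCross, add_torusDiagJump_apply_zero', add_torusDiagJump_zero_apply_one']
    have key : ZMod.toCircle ((m : ZMod L) * (x 0 + 1) * (x 1 + 1)) =
        ZMod.toCircle ((m : ZMod L) * x 0 * x 1) * ZMod.toCircle ((m : ZMod L) * x 0) *
          ZMod.toCircle ((m : ZMod L) * x 1) * (halfFluxPhase L m * halfFluxPhase L m) := by
      rw [halfFluxPhase_mul_self, ← AddChar.map_add_eq_mul, ← AddChar.map_add_eq_mul, ← AddChar.map_add_eq_mul]
      congr 1
      ring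
    rw [key]
    apply circle_eq_of_additive
    simp only [ofMul_mul, ofMul_inv]
    abel
  · obtain rfl : s = 1 := Fin.eq_one_of_ne_zero s hs
    rw [landauDiagAmp_one_apply, landauDiagAmpX_one_apply, ← Circle.coe_inv_eq_conj, ← Circle.coe_mul,
      ← Circle.coe_mul]
    congr 1
    simp only [landauCross, add_torusDiagJump_apply_zero', add_torusDiagJump_one_apply_one']
    rw [AddChar.map_neg_eq_inv]
    have key : ZMod.toCircle ((m : ZMod L) * (x 0 + 1) * (x 1 - 1)) =
        ZMod.toCircle ((m : ZMod L) * x 0 * x 1) * ZMod.toCircle ((m : ZMod L) * x 1) *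
          (ZMod.toCircle ((m : ZMod L) * x 0) * (halfFluxPhase L m * halfFluxPhase L m))⁻¹ := by
      rw [eq_mul_inv_iff_mul_eq, halfFluxPhase_mul_self, ← AddChar.map_add_eq_mul, ← AddChar.map_add_eq_mul,
        ← AddChar.map_add_eq_mul]
      congr 1
      ring
    rw [key]
    apply circle_eq_of_additive
    simp only [ofMul_mul, ofMul_inv]
    abel

/-- **The two Landau-gauge Hamiltonians are unitarily equivalent** (`W = phaseGauge landauCross`):
`Wᴴ · hubbardTorusTT'Plaquette L t' U m · W = H_{landauGaugeX}(1, U) − t'·D_{landauDiagAmpX}`.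
[cite: Watanabe2019, §2.2.1] -/
theorem conj_hubbardTorusTT'Plaquette_eq_landauX (t' U : ℝ) (m : ℤ) :
    (phaseGauge fun u : FermionTorus 2 L => landauCross L m u.toTorusSite)ᴴ * hubbardTorusTT'Plaquette L t' U m *
        phaseGauge (fun u : FermionTorus 2 L => landauCross L m u.toTorusSite) =
      magneticHubbardTorus L (landauGaugeX L m) 1 U + -(t' : ℂ) • diagPeierlsHopping L (landauDiagAmpX L m) := by
  rw [hubbardTorusTT'Plaquette, Matrix.mul_add, Matrix.add_mul, ← magneticHubbardTorus_gaugeTransform,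
    gaugeTransform_landauCross_landauGauge, Matrix.mul_smul, Matrix.smul_mul,
    conjTranspose_phaseGauge_mul_diagPeierlsHopping_mul_phaseGauge]
  congr 3
  funext s x
  exact landauCross_mul_landauDiagAmp_mul_conj L m s x

/-- **Equal sector energies in the two Landau gauges**, every sector `(N, S^z = M)`. [cite: Lieb1994, eqs. (1)-(2)] -/
theorem minEnergyOn_szSector_landauX_eq (t' U : ℝ) (m : ℤ) (N : ℕ) (M : ℝ) :
    (magneticHubbardTorus L (landauGaugeX L m) 1 U + -(t' : ℂ) • diagPeierlsHopping L (landauDiagAmpX L m)).minEnergyOn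
        (szSector N M) =
      (hubbardTorusTT'Plaquette L t' U m).minEnergyOn (szSector N M) := by
  rw [← conj_hubbardTorusTT'Plaquette_eq_landauX]
  exact minEnergyOn_szSector_phaseGauge_conj _ _ N M

/-! ### Magnetic translations -/

/-- Translation by `e₂` leaves the Landau field invariant. [cite: Zak1964, §2] -/
theorem landauGauge_shift_one (m : ℤ) (x : Site 2 L) (i : Fin 2) :
    landauGauge L m (x.shift 1, i) = landauGauge L m (x, i) := by
  by_cases hi : i = 0
  · subst hi
    rw [landauGauge_apply_zero, landauGauge_apply_zero]
  · obtain rfl : i = 1 := Fin.eq_one_of_ne_zero i hi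
    rw [landauGauge_apply_one, landauGauge_apply_one, shift_one_apply_zero'']

/-- Translation by `e₂` leaves the diagonal phases invariant. [cite: Zak1964, §2] -/
theorem landauDiagAmp_shift_one (m : ℤ) (s : Fin 2) (x : Site 2 L) :
    landauDiagAmp L m s (x.shift 1) = landauDiagAmp L m s x := by
  simp only [landauDiagAmp, shift_one_apply_zero'']

/-- **Translation by `e₁` is a gauge transformation of the Landau field** (the magnetic translation):
`A(x + e₁, i) = (gaugeTransform (y ↦ χ(−m y₂)) A)(x, i)`. [cite: Zak1964, §2] -/
theorem landauGauge_shift_zero (m : ℤ) (x : Site 2 L) (i : Fin 2) :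
    landauGauge L m (x.shift 0, i) =
      gaugeTransform (fun y : Site 2 L => ZMod.toCircle (-((m : ZMod L) * y 1))) (landauGauge L m) (x, i) := by
  simp only [gaugeTransform]
  by_cases hi : i = 0
  · subst hi
    rw [landauGauge_apply_zero, landauGauge_apply_zero, mul_one, shift_zero_apply_one', mul_inv_cancel]
  · obtain rfl : i = 1 := Fin.eq_one_of_ne_zero i hi
    rw [landauGauge_apply_one, landauGauge_apply_one, shift_zero_apply_zero'', shift_one_apply_one',
      ← AddChar.map_neg_eq_inv, ← AddChar.map_add_eq_mul, ← AddChar.map_add_eq_mul,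
      show -((m : ZMod L) * x 1) + (m : ZMod L) * x 0 + - -((m : ZMod L) * (x 1 + 1)) = m * (x 0 + 1) by ring]

/-- **Translation by `e₁` transforms the diagonal phases by the same gauge**:
`a_s(x + e₁) = χ(−m x₂)·a_s(x)·conj χ(−m (x + j_s)₂)`. [cite: Zak1964, §2] -/
theorem landauDiagAmp_shift_zero (m : ℤ) (s : Fin 2) (x : Site 2 L) :
    landauDiagAmp L m s (x.shift 0) =
      ((ZMod.toCircle (-((m : ZMod L) * x 1)) : Circle) : ℂ) * landauDiagAmp L m s x *
        conj ((ZMod.toCircle (-((m : ZMod L) * (x + torusDiagJump L s) 1)) : Circle) : ℂ) := by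
  by_cases hs : s = 0
  · subst hs
    rw [landauDiagAmp_zero_apply, landauDiagAmp_zero_apply, ← Circle.coe_inv_eq_conj, ← Circle.coe_mul,
      ← Circle.coe_mul, shift_zero_apply_zero'', add_torusDiagJump_zero_apply_one']
    congr 1
    rw [AddChar.map_neg_eq_inv, AddChar.map_neg_eq_inv]
    have key : ZMod.toCircle ((m : ZMod L) * (x 1 + 1)) =
        ZMod.toCircle ((m : ZMod L) * x 1) * ZMod.toCircle ((m : ZMod L) * (x 0 + 1)) *
          (ZMod.toCircle ((m : ZMod L) * x 0))⁻¹ := by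
      rw [eq_mul_inv_iff_mul_eq, ← AddChar.map_add_eq_mul, ← AddChar.map_add_eq_mul]
      congr 1
      ring
    rw [key]
    apply circle_eq_of_additive
    simp only [ofMul_mul, ofMul_inv]
    abel
  · obtain rfl : s = 1 := Fin.eq_one_of_ne_zero s hs
    rw [landauDiagAmp_one_apply, landauDiagAmp_one_apply, ← Circle.coe_inv_eq_conj, ← Circle.coe_mul,
      ← Circle.coe_mul, shift_zero_apply_zero'', add_torusDiagJump_one_apply_one']
    congr 1
    rw [AddChar.map_neg_eq_inv, AddChar.map_neg_eq_inv]
    have key : ZMod.toCircle ((m : ZMod L) * (x 1 - 1)) =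
        ZMod.toCircle ((m : ZMod L) * x 1) * ZMod.toCircle ((m : ZMod L) * x 0) *
          (ZMod.toCircle ((m : ZMod L) * (x 0 + 1)))⁻¹ := by
      rw [eq_mul_inv_iff_mul_eq, ← AddChar.map_add_eq_mul, ← AddChar.map_add_eq_mul]
      congr 1
      ring
    rw [key]
    apply circle_eq_of_additive
    simp only [ofMul_mul, ofMul_inv]
    abel

end Literature.MathematicalPhysics.QuantumLattice
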